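import Mathlib
import Summits.AtomisticToContinuum.Crystallization.Theorems.ChessboardParticlePlanesLjLaminarWindowsPinnedSqueeze
import Summits.AtomisticToContinuum.Crystallization.Theorems.ChessboardParticlePlanesLjLaminarWindowsPinnedGluing
import Summits.AtomisticToContinuum.Crystallization.Theorems.ChessboardParticlePlanesLjLaminarWindowsOneWindowAllScales
import HarnessLib

/-!
# The block-level door of line `stacking-blind-budget-flatness` — crux `ChessboardParticlePlanes.LjLaminarWindows`
# (stmt-AtomisticToContinuum-6711) from `ZeroDefectDensity`, `SplitCoercivity` and the PINNING CHARGE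

This file lands, as ONE tree theorem, the planner's original (block-level) composition of the line
(`Cruxes/LjLaminarWindows/Lines/stacking_blind_budget_flatness.lean`, `LjLaminarWindows_of_blocks`, rev 1–4):

`oneWindowAllScales_of_blockCoercivity` / `stub_blockWindows : ZeroDefectDensity → SplitCoercivity → (pinning charge, raw registered form) → S9♭`
and `LjLaminarWindows_of_blockCoercivity : … → LjLaminarWindows` (through p137588).

Inputs, all by name or verbatim: item stmt-13604 `ReggeStarCoercivity.ZeroDefectDensity`; the word-uniform layered coercivity
`PrestressSplitKorn.SplitCoercivity` (registered stub `stub_splitCoercivity`); the PINNING CHARGE in the raw form of the registered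
stub `stub_pinningCharge` (sites whose `2`-ball is `η`-layered in the cone's box but not in the PINNED box — height increments
`≥ 19/25` — are charged with slack).  Everything else is LANDED: pinned gluing `stub_pinnedGluing` (p159322), the generic squeeze
`gsqueeze_tendsto_card_div`, clean centres `eventually_exists_clean_centre` and the laminar reading `laminar_of_pinnedMatching`
(p157869), the one-window reduction `LjLaminarWindowsSketch.LjLaminarWindows_of_oneWindowAllScales` (p137588), the minimal distance of
Lennard-Jones ground states.  New here: the cover lemma `coercivity_of_cover` (two slack-coercive charges on `P₁`, `P₂` give one on any
`P ⊆ P₁ ∪ P₂`) and the assembly.  Unlike the line's primary (law-level) composition, the three inputs of this door are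
finite-configuration statements stated over cone-neutral vocabulary, so the door is insensitive to the `MuGSC` /
`MuGroundStateConfiguration` import split.  Conditional result (door); nothing is claimed about the three inputs.
-/

noncomputable section

open scoped BigOperators Classical
open Filter Topology

namespace Summit.AtomisticToContinuum.Crystallization.Theorems.StackingBlindBudgetFlatness

open Literature.MathematicalPhysics.StatisticalMechanics Literature.Geometry.DiscreteGeometry
open Summit.AtomisticToContinuum.Crystallization.Theses.ReggeStarCoercivity (ZeroDefectDensity)
open Summit.AtomisticToContinuum.Crystallization.Theorems.PrestressSplitKorn
open Summit.AtomisticToContinuum.Crystallization.Theorems.DefectFreeCrystallizes.Negative.PredicateAPI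
  (Good defects)

/-! ## Two slack-coercive charges combine -/

/-- **Combination of two slack-coercivity inequalities** (raw `SlackCoercive` shape of the line): if `P ⊆ P₁ ∪ P₂` sitewise,
charges on `P₁` and on `P₂` give a charge on `P` (half the smaller charge; slack halved; depths and boundary constants merged
by `max`). [folklore] -/
theorem coercivity_of_cover {P P₁ P₂ : (N : ℕ) → (Fin N → EuclideanSpace ℝ (Fin 3)) → Fin N → Prop}
    [∀ (N : ℕ) (x : Fin N → EuclideanSpace ℝ (Fin 3)), DecidablePred (P N x)] [∀ (N : ℕ) (x : Fin N → EuclideanSpace ℝ (Fin 3)), DecidablePred (P₁ N x)]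
    [∀ (N : ℕ) (x : Fin N → EuclideanSpace ℝ (Fin 3)), DecidablePred (P₂ N x)] {δ : ℝ}
    (h₁ : ∃ c : ℝ, 0 < c ∧ ∀ θ : ℝ, 0 < θ → ∃ ρ C : ℝ, 0 < ρ ∧
      ∀ (N : ℕ) (x : Fin N → EuclideanSpace ℝ (Fin 3)), (∀ i j : Fin N, i ≠ j → δ ≤ dist (x i) (x j)) →
      ∀ Ω : Finset (Fin N), (∀ i ∈ Ω, ∀ j : Fin N, dist (x j) (x i) ≤ ρ → Good x j) →
        c * ((Ω.filter fun i => P₁ N x i).card : ℝ)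
            - C * ((Ω.filter fun i => ∃ j : Fin N, j ∉ Ω ∧ dist (x j) (x i) ≤ ρ).card : ℝ)
            - θ * (Ω.card : ℝ)
          ≤ ∑ i ∈ Ω, ((1 / 2 : ℝ) * siteEnergy lennardJones x i -
              ⨅ Q : PeriodicConfiguration 3, Q.energyPerParticle lennardJones))
    (h₂ : ∃ c : ℝ, 0 < c ∧ ∀ θ : ℝ, 0 < θ → ∃ ρ C : ℝ, 0 < ρ ∧
      ∀ (N : ℕ) (x : Fin N → EuclideanSpace ℝ (Fin 3)), (∀ i j : Fin N, i ≠ j → δ ≤ dist (x i) (x j)) →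
      ∀ Ω : Finset (Fin N), (∀ i ∈ Ω, ∀ j : Fin N, dist (x j) (x i) ≤ ρ → Good x j) →
        c * ((Ω.filter fun i => P₂ N x i).card : ℝ)
            - C * ((Ω.filter fun i => ∃ j : Fin N, j ∉ Ω ∧ dist (x j) (x i) ≤ ρ).card : ℝ)
            - θ * (Ω.card : ℝ)
          ≤ ∑ i ∈ Ω, ((1 / 2 : ℝ) * siteEnergy lennardJones x i -
              ⨅ Q : PeriodicConfiguration 3, Q.energyPerParticle lennardJones))
    (hcov : ∀ (N : ℕ) (x : Fin N → EuclideanSpace ℝ (Fin 3)) (i : Fin N), P N x i → P₁ N x i ∨ P₂ N x i) :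
    ∃ c : ℝ, 0 < c ∧ ∀ θ : ℝ, 0 < θ → ∃ ρ C : ℝ, 0 < ρ ∧
      ∀ (N : ℕ) (x : Fin N → EuclideanSpace ℝ (Fin 3)), (∀ i j : Fin N, i ≠ j → δ ≤ dist (x i) (x j)) →
      ∀ Ω : Finset (Fin N), (∀ i ∈ Ω, ∀ j : Fin N, dist (x j) (x i) ≤ ρ → Good x j) →
        c * ((Ω.filter fun i => P N x i).card : ℝ)
            - C * ((Ω.filter fun i => ∃ j : Fin N, j ∉ Ω ∧ dist (x j) (x i) ≤ ρ).card : ℝ)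
            - θ * (Ω.card : ℝ)
          ≤ ∑ i ∈ Ω, ((1 / 2 : ℝ) * siteEnergy lennardJones x i -
              ⨅ Q : PeriodicConfiguration 3, Q.energyPerParticle lennardJones) := by
  obtain ⟨c₁, hc₁, H₁⟩ := h₁
  obtain ⟨c₂, hc₂, H₂⟩ := h₂
  refine ⟨min c₁ c₂ / 2, by positivity, fun θ hθ => ?_⟩
  obtain ⟨ρ₁, C₁, hρ₁, G₁⟩ := H₁ (θ / 2) (by positivity)
  obtain ⟨ρ₂, C₂, hρ₂, G₂⟩ := H₂ (θ / 2) (by positivity)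
  refine ⟨max ρ₁ ρ₂, (max C₁ 0 + max C₂ 0) / 2, lt_max_of_lt_left hρ₁, fun N x hsep Ω hΩ => ?_⟩
  -- both inequalities apply to `Ω`
  have hΩ₁ : ∀ i ∈ Ω, ∀ j : Fin N, dist (x j) (x i) ≤ ρ₁ → Good x j :=
    fun i hi j hj => hΩ i hi j (hj.trans (le_max_left _ _))
  have hΩ₂ : ∀ i ∈ Ω, ∀ j : Fin N, dist (x j) (x i) ≤ ρ₂ → Good x j :=
    fun i hi j hj => hΩ i hi j (hj.trans (le_max_right _ _))
  have I₁ := G₁ N x hsep Ω hΩ₁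
  have I₂ := G₂ N x hsep Ω hΩ₂
  -- boundary layers at depth `ρ_k` are contained in the boundary layer at depth `max ρ₁ ρ₂`
  set B := (Ω.filter fun i => ∃ j : Fin N, j ∉ Ω ∧ dist (x j) (x i) ≤ max ρ₁ ρ₂) with hB
  have hB₁ : ((Ω.filter fun i => ∃ j : Fin N, j ∉ Ω ∧ dist (x j) (x i) ≤ ρ₁).card : ℝ) ≤ B.card := by
    have hsub : (Ω.filter fun i => ∃ j : Fin N, j ∉ Ω ∧ dist (x j) (x i) ≤ ρ₁) ⊆ B := by
      intro i hi
      obtain ⟨hiΩ, j, hj, hd⟩ := Finset.mem_filter.1 hi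
      exact Finset.mem_filter.2 ⟨hiΩ, j, hj, hd.trans (le_max_left _ _)⟩
    exact_mod_cast Finset.card_le_card hsub
  have hB₂ : ((Ω.filter fun i => ∃ j : Fin N, j ∉ Ω ∧ dist (x j) (x i) ≤ ρ₂).card : ℝ) ≤ B.card := by
    have hsub : (Ω.filter fun i => ∃ j : Fin N, j ∉ Ω ∧ dist (x j) (x i) ≤ ρ₂) ⊆ B := by
      intro i hi
      obtain ⟨hiΩ, j, hj, hd⟩ := Finset.mem_filter.1 hi
      exact Finset.mem_filter.2 ⟨hiΩ, j, hj, hd.trans (le_max_right _ _)⟩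
    exact_mod_cast Finset.card_le_card hsub
  -- the charged set of `P` is covered by those of `P₁` and `P₂`
  have hcard : ((Ω.filter fun i => P N x i).card : ℝ) ≤
      ((Ω.filter fun i => P₁ N x i).card : ℝ) + ((Ω.filter fun i => P₂ N x i).card : ℝ) := by
    have hsub : (Ω.filter fun i => P N x i) ⊆ (Ω.filter fun i => P₁ N x i) ∪ (Ω.filter fun i => P₂ N x i) := by
      intro i hi
      obtain ⟨hiΩ, hPi⟩ := Finset.mem_filter.1 hi
      rcases hcov N x i hPi with h | h
      · exact Finset.mem_union_left _ (Finset.mem_filter.2 ⟨hiΩ, h⟩)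
      · exact Finset.mem_union_right _ (Finset.mem_filter.2 ⟨hiΩ, h⟩)
    calc ((Ω.filter fun i => P N x i).card : ℝ)
        ≤ (((Ω.filter fun i => P₁ N x i) ∪ (Ω.filter fun i => P₂ N x i)).card : ℝ) := by
          exact_mod_cast Finset.card_le_card hsub
      _ ≤ _ := by exact_mod_cast Finset.card_union_le _ _
  -- bookkeeping
  have hC₁ : C₁ * ((Ω.filter fun i => ∃ j : Fin N, j ∉ Ω ∧ dist (x j) (x i) ≤ ρ₁).card : ℝ) ≤
      max C₁ 0 * B.card :=
    calc C₁ * ((Ω.filter fun i => ∃ j : Fin N, j ∉ Ω ∧ dist (x j) (x i) ≤ ρ₁).card : ℝ)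
        ≤ max C₁ 0 * ((Ω.filter fun i => ∃ j : Fin N, j ∉ Ω ∧ dist (x j) (x i) ≤ ρ₁).card : ℝ) :=
          mul_le_mul_of_nonneg_right (le_max_left _ _) (by positivity)
      _ ≤ max C₁ 0 * B.card := mul_le_mul_of_nonneg_left hB₁ (le_max_right _ _)
  have hC₂ : C₂ * ((Ω.filter fun i => ∃ j : Fin N, j ∉ Ω ∧ dist (x j) (x i) ≤ ρ₂).card : ℝ) ≤
      max C₂ 0 * B.card :=
    calc C₂ * ((Ω.filter fun i => ∃ j : Fin N, j ∉ Ω ∧ dist (x j) (x i) ≤ ρ₂).card : ℝ)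
        ≤ max C₂ 0 * ((Ω.filter fun i => ∃ j : Fin N, j ∉ Ω ∧ dist (x j) (x i) ≤ ρ₂).card : ℝ) :=
          mul_le_mul_of_nonneg_right (le_max_left _ _) (by positivity)
      _ ≤ max C₂ 0 * B.card := mul_le_mul_of_nonneg_left hB₂ (le_max_right _ _)
  have hmin₁ : min c₁ c₂ ≤ c₁ := min_le_left _ _
  have hmin₂ : min c₁ c₂ ≤ c₂ := min_le_right _ _
  have hmin0 : 0 < min c₁ c₂ := lt_min hc₁ hc₂
  have hP₁ : 0 ≤ ((Ω.filter fun i => P₁ N x i).card : ℝ) := by positivity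
  have hP₂ : 0 ≤ ((Ω.filter fun i => P₂ N x i).card : ℝ) := by positivity
  have hΩ0 : 0 ≤ (Ω.card : ℝ) := by positivity
  nlinarith [mul_le_mul_of_nonneg_right hmin₁ hP₁, mul_le_mul_of_nonneg_right hmin₂ hP₂,
    mul_le_mul_of_nonneg_left hcard hmin0.le]

/-! ## The door -/

/-- **ALT B of the line at the one-window level: `ZeroDefectDensity → SplitCoercivity → PinningCharge → S9♭`** (an `η`-laminar closed
`L`-window for every `L`, frequently in `N`, along every Lennard-Jones ground-state sequence).
Along a Lennard-Jones ground-state sequence (minimal distance `δ`): pinned gluing (landed `stub_pinnedGluing`) fixes, for the scale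
`(L, η)`, a tolerance `η' > 0` and a radius `R'`; at the capped tolerance `η₁ = min η' (1/20)` the layered coercivity (charge on
non-`η₁`-layered sites) and the pinning charge (charge on `η₁`-layered but non-pinned sites) combine (`coercivity_of_cover`) into a
charge on ALL non-pinned sites, so the generic squeeze (`gsqueeze_tendsto_card_div`, where the minimality budget and the zero defect
density are spent) makes the non-pinned fraction vanish; packing (`eventually_exists_clean_centre`) gives, for all large `N`, a particle
all of whose `R'`-neighbours are good and pinned; gluing makes it carry a pinned window of radius `L` and tolerance `η`, which
`laminar_of_pinnedMatching` reads as an `η`-laminar closed `L`-window with `3/4`-separated heights (`19/25 ≥ 3/4`); this is S9♭ for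
every `L`, eventually (hence frequently) in `N`, and `LjLaminarWindowsSketch.LjLaminarWindows_of_oneWindowAllScales` (p137588) supplies
the crux's `7/10`-separation and energy clause.  Conditional result (door): the three hypotheses are item stmt-13604 and the two
registered XL stubs `stub_splitCoercivity` / `stub_pinningCharge` of the line, nothing is claimed about them. [folklore] -/
theorem oneWindowAllScales_of_blockCoercivity
    (hZ : ZeroDefectDensity) (hSC : SplitCoercivity)
    (hPC : ∀ δ : ℝ, 0 < δ → ∀ η : ℝ, 0 < η → η ≤ 1 / 20 →
      ∃ c : ℝ, 0 < c ∧ ∀ θ : ℝ, 0 < θ → ∃ ρ C : ℝ, 0 < ρ ∧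
        ∀ (N : ℕ) (x : Fin N → EuclideanSpace ℝ (Fin 3)), (∀ i j : Fin N, i ≠ j → δ ≤ dist (x i) (x j)) →
        ∀ Ω : Finset (Fin N), (∀ i ∈ Ω, ∀ j : Fin N, dist (x j) (x i) ≤ ρ → Good x j) →
          c * ((Ω.filter fun i => LayeredNear η x i ∧
                ¬ ∃ (A : EuclideanSpace ℝ (Fin 3) →ₗᵢ[ℝ] EuclideanSpace ℝ (Fin 3)) (t : EuclideanSpace ℝ (Fin 3))
                    (a : ℝ) (s : ℤ → ℤ) (z : ℤ → ℝ),
                  (InBox a z ∧ ∀ m : ℤ, 19 / 25 ≤ z (m + 1) - z m) ∧ IsHaggSeq s ∧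
                  (∀ j : Fin N, dist (x j) (x i) ≤ 2 →
                    ∃ l : ℤ × ℤ × ℤ, dist (x j + t) (A (layeredPos a s z l)) ≤ η) ∧
                  (∀ l : ℤ × ℤ × ℤ, dist (A (layeredPos a s z l)) (x i + t) ≤ 2 →
                    ∃ j : Fin N, dist (x j + t) (A (layeredPos a s z l)) ≤ η)).card : ℝ)
            - C * ((Ω.filter fun i => ∃ j : Fin N, j ∉ Ω ∧ dist (x j) (x i) ≤ ρ).card : ℝ)
            - θ * (Ω.card : ℝ)
          ≤ ∑ i ∈ Ω, ((1 / 2 : ℝ) * siteEnergy lennardJones x i -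
              ⨅ Q : PeriodicConfiguration 3, Q.energyPerParticle lennardJones)) :
    ∀ x : (N : ℕ) → (Fin N → EuclideanSpace ℝ (Fin 3)),
      (∀ N, IsGroundState lennardJones (x N)) →
      ∀ η : ℝ, 0 < η → ∀ L : ℝ, ∃ᶠ N in Filter.atTop,
        ∃ (i : Fin N) (A : EuclideanSpace ℝ (Fin 3) →ₗᵢ[ℝ] EuclideanSpace ℝ (Fin 3)) (T : Set ℝ),
          (∀ t ∈ T, ∀ t' ∈ T, t ≠ t' → (3 : ℝ) / 4 ≤ |t - t'|) ∧
          (∀ j : Fin N, dist (x N j) (x N i) ≤ L → ∃ t ∈ T, |(A (x N j - x N i)) 2 - t| ≤ η) := by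
  intro x hx η hη L
  obtain ⟨δ, hδ, hsepall⟩ := LennardJonesMinimalDistance_holds
  obtain ⟨η', hη', R', hglue⟩ := stub_pinnedGluing δ hδ L η hη
  -- the squeeze runs at the capped tolerance `η₁ = min η' (1/20)`
  set η₁ : ℝ := min η' (1 / 20) with hη₁
  have hη₁0 : 0 < η₁ := lt_min hη' (by norm_num)
  have hη₁c : η₁ ≤ 1 / 20 := min_le_right _ _
  have hη₁η : η₁ ≤ η' := min_le_left _ _
  -- (1) a slack-coercive charge on ALL non-pinned sites at tolerance `η₁`, for every separation `δ'`
  have hcoer : ∀ δ' : ℝ, 0 < δ' → ∃ c : ℝ, 0 < c ∧ ∀ θ : ℝ, 0 < θ → ∃ ρ C : ℝ, 0 < ρ ∧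
      ∀ (N : ℕ) (y : Fin N → EuclideanSpace ℝ (Fin 3)), (∀ i j : Fin N, i ≠ j → δ' ≤ dist (y i) (y j)) →
      ∀ Ω : Finset (Fin N), (∀ i ∈ Ω, ∀ j : Fin N, dist (y j) (y i) ≤ ρ → Good y j) →
        c * ((Ω.filter fun i => ¬ ∃ (A : EuclideanSpace ℝ (Fin 3) →ₗᵢ[ℝ] EuclideanSpace ℝ (Fin 3)) (t : EuclideanSpace ℝ (Fin 3)) (a : ℝ) (s : ℤ → ℤ) (z : ℤ → ℝ),
          (InBox a z ∧ ∀ m : ℤ, 19 / 25 ≤ z (m + 1) - z m) ∧ IsHaggSeq s ∧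
          (∀ k : Fin N, dist (y k) (y i) ≤ 2 → ∃ l : ℤ × ℤ × ℤ, dist (y k + t) (A (layeredPos a s z l)) ≤ η₁) ∧
          (∀ l : ℤ × ℤ × ℤ, dist (A (layeredPos a s z l)) (y i + t) ≤ 2 →
            ∃ k : Fin N, dist (y k + t) (A (layeredPos a s z l)) ≤ η₁)).card : ℝ)
            - C * ((Ω.filter fun i => ∃ j : Fin N, j ∉ Ω ∧ dist (y j) (y i) ≤ ρ).card : ℝ)
            - θ * (Ω.card : ℝ)
          ≤ ∑ i ∈ Ω, ((1 / 2 : ℝ) * siteEnergy lennardJones y i -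
              ⨅ Q : PeriodicConfiguration 3, Q.energyPerParticle lennardJones) := by
    intro δ' hδ'
    have key := coercivity_of_cover (δ := δ')
      (P := fun N y i => ¬ ∃ (A : EuclideanSpace ℝ (Fin 3) →ₗᵢ[ℝ] EuclideanSpace ℝ (Fin 3)) (t : EuclideanSpace ℝ (Fin 3)) (a : ℝ) (s : ℤ → ℤ) (z : ℤ → ℝ),
          (InBox a z ∧ ∀ m : ℤ, 19 / 25 ≤ z (m + 1) - z m) ∧ IsHaggSeq s ∧
          (∀ k : Fin N, dist (y k) (y i) ≤ 2 → ∃ l : ℤ × ℤ × ℤ, dist (y k + t) (A (layeredPos a s z l)) ≤ η₁) ∧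
          (∀ l : ℤ × ℤ × ℤ, dist (A (layeredPos a s z l)) (y i + t) ≤ 2 →
            ∃ k : Fin N, dist (y k + t) (A (layeredPos a s z l)) ≤ η₁))
      (P₁ := fun N y i => ¬ LayeredNear η₁ y i)
      (P₂ := fun N y i => LayeredNear η₁ y i ∧ ¬ ∃ (A : EuclideanSpace ℝ (Fin 3) →ₗᵢ[ℝ] EuclideanSpace ℝ (Fin 3)) (t : EuclideanSpace ℝ (Fin 3)) (a : ℝ) (s : ℤ → ℤ) (z : ℤ → ℝ),
          (InBox a z ∧ ∀ m : ℤ, 19 / 25 ≤ z (m + 1) - z m) ∧ IsHaggSeq s ∧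
          (∀ k : Fin N, dist (y k) (y i) ≤ 2 → ∃ l : ℤ × ℤ × ℤ, dist (y k + t) (A (layeredPos a s z l)) ≤ η₁) ∧
          (∀ l : ℤ × ℤ × ℤ, dist (A (layeredPos a s z l)) (y i + t) ≤ 2 →
            ∃ k : Fin N, dist (y k + t) (A (layeredPos a s z l)) ≤ η₁))
      (by simpa only [Finset.filter_congr_decidable] using hSC δ' hδ' η₁ hη₁0)
      (by simpa only [Finset.filter_congr_decidable] using hPC δ' hδ' η₁ hη₁0 hη₁c)
      (fun N y i hi => by
        by_cases h : LayeredNear η₁ y i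
        · exact Or.inr ⟨h, hi⟩
        · exact Or.inl h)
    simpa only [Finset.filter_congr_decidable] using key
  -- (2) the squeeze: the non-pinned fraction vanishes along the sequence (minimality + zero defect density spent here)
  have hdef : Tendsto (fun N : ℕ => (defects (x N) : ℝ) / N) atTop (𝓝 0) := hZ x hx
  have hL : Tendsto (fun N : ℕ =>
      ((Finset.univ.filter fun i => ¬ ∃ (A : EuclideanSpace ℝ (Fin 3) →ₗᵢ[ℝ] EuclideanSpace ℝ (Fin 3)) (t : EuclideanSpace ℝ (Fin 3)) (a : ℝ) (s : ℤ → ℤ) (z : ℤ → ℝ),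
          (InBox a z ∧ ∀ m : ℤ, 19 / 25 ≤ z (m + 1) - z m) ∧ IsHaggSeq s ∧
          (∀ k : Fin N, dist (x N k) (x N i) ≤ 2 → ∃ l : ℤ × ℤ × ℤ, dist (x N k + t) (A (layeredPos a s z l)) ≤ η₁) ∧
          (∀ l : ℤ × ℤ × ℤ, dist (A (layeredPos a s z l)) (x N i + t) ≤ 2 →
            ∃ k : Fin N, dist (x N k + t) (A (layeredPos a s z l)) ≤ η₁)).card : ℝ) / N) atTop (𝓝 0) := by
    have key := gsqueeze_tendsto_card_div (fun N y i => ¬ ∃ (A : EuclideanSpace ℝ (Fin 3) →ₗᵢ[ℝ] EuclideanSpace ℝ (Fin 3)) (t : EuclideanSpace ℝ (Fin 3)) (a : ℝ) (s : ℤ → ℤ) (z : ℤ → ℝ),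
          (InBox a z ∧ ∀ m : ℤ, 19 / 25 ≤ z (m + 1) - z m) ∧ IsHaggSeq s ∧
          (∀ k : Fin N, dist (y k) (y i) ≤ 2 → ∃ l : ℤ × ℤ × ℤ, dist (y k + t) (A (layeredPos a s z l)) ≤ η₁) ∧
          (∀ l : ℤ × ℤ × ℤ, dist (A (layeredPos a s z l)) (y i + t) ≤ 2 →
            ∃ k : Fin N, dist (y k + t) (A (layeredPos a s z l)) ≤ η₁)) hcoer x hx hdef
    simpa only [Finset.filter_congr_decidable] using key
  -- (3) packing: a clean, pinned centre of radius `R'`, eventually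
  have hcentre : ∀ᶠ N : ℕ in atTop, ∃ i : Fin N, ∀ j : Fin N, dist (x N j) (x N i) ≤ R' →
      Good (x N) j ∧ ∃ (A : EuclideanSpace ℝ (Fin 3) →ₗᵢ[ℝ] EuclideanSpace ℝ (Fin 3)) (t : EuclideanSpace ℝ (Fin 3)) (a : ℝ) (s : ℤ → ℤ) (z : ℤ → ℝ),
          (InBox a z ∧ ∀ m : ℤ, 19 / 25 ≤ z (m + 1) - z m) ∧ IsHaggSeq s ∧
          (∀ k : Fin N, dist (x N k) (x N j) ≤ 2 → ∃ l : ℤ × ℤ × ℤ, dist (x N k + t) (A (layeredPos a s z l)) ≤ η₁) ∧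
          (∀ l : ℤ × ℤ × ℤ, dist (A (layeredPos a s z l)) (x N j + t) ≤ 2 →
            ∃ k : Fin N, dist (x N k + t) (A (layeredPos a s z l)) ≤ η₁) := by
    refine eventually_exists_clean_centre (fun N y i => Good y i ∧ ∃ (A : EuclideanSpace ℝ (Fin 3) →ₗᵢ[ℝ] EuclideanSpace ℝ (Fin 3)) (t : EuclideanSpace ℝ (Fin 3)) (a : ℝ) (s : ℤ → ℤ) (z : ℤ → ℝ),
          (InBox a z ∧ ∀ m : ℤ, 19 / 25 ≤ z (m + 1) - z m) ∧ IsHaggSeq s ∧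
          (∀ k : Fin N, dist (y k) (y i) ≤ 2 → ∃ l : ℤ × ℤ × ℤ, dist (y k + t) (A (layeredPos a s z l)) ≤ η₁) ∧
          (∀ l : ℤ × ℤ × ℤ, dist (A (layeredPos a s z l)) (y i + t) ≤ 2 →
            ∃ k : Fin N, dist (y k + t) (A (layeredPos a s z l)) ≤ η₁)) x hx ?_ R'
    -- the fraction of sites that are defective or non-pinned vanishes (union bound; instances read off the goal)
    have hsum : Tendsto (fun N : ℕ => (defects (x N) : ℝ) / N +
        ((Finset.univ.filter fun i => ¬ ∃ (A : EuclideanSpace ℝ (Fin 3) →ₗᵢ[ℝ] EuclideanSpace ℝ (Fin 3)) (t : EuclideanSpace ℝ (Fin 3)) (a : ℝ) (s : ℤ → ℤ) (z : ℤ → ℝ),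
          (InBox a z ∧ ∀ m : ℤ, 19 / 25 ≤ z (m + 1) - z m) ∧ IsHaggSeq s ∧
          (∀ k : Fin N, dist (x N k) (x N i) ≤ 2 → ∃ l : ℤ × ℤ × ℤ, dist (x N k + t) (A (layeredPos a s z l)) ≤ η₁) ∧
          (∀ l : ℤ × ℤ × ℤ, dist (A (layeredPos a s z l)) (x N i + t) ≤ 2 →
            ∃ k : Fin N, dist (x N k + t) (A (layeredPos a s z l)) ≤ η₁)).card : ℝ) / N) atTop (𝓝 0) := by
      simpa using hdef.add hL
    refine squeeze_zero (fun N => by positivity) (fun N => ?_) hsum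
    rw [← add_div]
    refine div_le_div_of_nonneg_right ?_ (Nat.cast_nonneg N)
    rw [squeeze_defects_eq_card_filter]
    have key : ∀ s t u : Finset (Fin N), s ⊆ t ∪ u → ((s.card : ℝ)) ≤ (t.card : ℝ) + (u.card : ℝ) := by
      intro s t u h
      exact_mod_cast (Finset.card_le_card h).trans (Finset.card_union_le t u)
    refine key _ _ _ fun j hj => ?_
    -- (the filter instance of the packing lemma is not the canonical one: let `simp` unify it)
    simp only [Finset.mem_filter, Finset.mem_univ, true_and] at hj
    rcases not_and_or.1 hj with h | h
    · exact Finset.mem_union_left _ (Finset.mem_filter.2 ⟨Finset.mem_univ _, h⟩)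
    · exact Finset.mem_union_right _ (Finset.mem_filter.2 ⟨Finset.mem_univ _, h⟩)
  -- (4) gluing at the clean centre (tolerance `η₁ ≤ η'`), then the laminar reading
  refine Filter.Eventually.frequently ?_
  filter_upwards [hcentre] with N hN
  obtain ⟨i, hi⟩ := hN
  have hwin := hglue N (x N) (hsepall N (x N) (hx N)) i fun j hj => by
    refine ⟨(hi j hj).1, ?_⟩
    obtain ⟨A, t, a, s, z, hbox, hs, h1, h2⟩ := (hi j hj).2
    refine ⟨A, t, a, s, z, hbox, hs, fun k hk => ?_, fun l hl => ?_⟩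
    · obtain ⟨l, hl⟩ := h1 k hk
      exact ⟨l, hl.trans hη₁η⟩
    · obtain ⟨k, hk⟩ := h2 l hl
      exact ⟨k, hk.trans hη₁η⟩
  obtain ⟨A, t, a, s, z, hbox, -, h1, -⟩ := hwin
  obtain ⟨A', T, hT, hlam⟩ := laminar_of_pinnedMatching hbox.2 h1
  exact ⟨i, A', T, hT, hlam⟩


/-- **ALT B of the line, by name: `ZeroDefectDensity → SplitCoercivity → PinningCharge → LjLaminarWindows`**, through
`oneWindowAllScales_of_blockCoercivity` and the landed one-window reduction `LjLaminarWindowsSketch.LjLaminarWindows_of_oneWindowAllScales`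
(p137588), which supplies the crux's `7/10`-separation and energy clause.  Conditional result (door): the three hypotheses are item
stmt-13604 and the two registered XL stubs `stub_splitCoercivity` / `stub_pinningCharge` of the line; nothing is claimed about them. [folklore] -/
theorem LjLaminarWindows_of_blockCoercivity
    (hZ : ZeroDefectDensity) (hSC : SplitCoercivity)
    (hPC : ∀ δ : ℝ, 0 < δ → ∀ η : ℝ, 0 < η → η ≤ 1 / 20 →
      ∃ c : ℝ, 0 < c ∧ ∀ θ : ℝ, 0 < θ → ∃ ρ C : ℝ, 0 < ρ ∧
        ∀ (N : ℕ) (x : Fin N → EuclideanSpace ℝ (Fin 3)), (∀ i j : Fin N, i ≠ j → δ ≤ dist (x i) (x j)) →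
        ∀ Ω : Finset (Fin N), (∀ i ∈ Ω, ∀ j : Fin N, dist (x j) (x i) ≤ ρ → Good x j) →
          c * ((Ω.filter fun i => LayeredNear η x i ∧
                ¬ ∃ (A : EuclideanSpace ℝ (Fin 3) →ₗᵢ[ℝ] EuclideanSpace ℝ (Fin 3)) (t : EuclideanSpace ℝ (Fin 3))
                    (a : ℝ) (s : ℤ → ℤ) (z : ℤ → ℝ),
                  (InBox a z ∧ ∀ m : ℤ, 19 / 25 ≤ z (m + 1) - z m) ∧ IsHaggSeq s ∧
                  (∀ j : Fin N, dist (x j) (x i) ≤ 2 →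
                    ∃ l : ℤ × ℤ × ℤ, dist (x j + t) (A (layeredPos a s z l)) ≤ η) ∧
                  (∀ l : ℤ × ℤ × ℤ, dist (A (layeredPos a s z l)) (x i + t) ≤ 2 →
                    ∃ j : Fin N, dist (x j + t) (A (layeredPos a s z l)) ≤ η)).card : ℝ)
            - C * ((Ω.filter fun i => ∃ j : Fin N, j ∉ Ω ∧ dist (x j) (x i) ≤ ρ).card : ℝ)
            - θ * (Ω.card : ℝ)
          ≤ ∑ i ∈ Ω, ((1 / 2 : ℝ) * siteEnergy lennardJones x i -
              ⨅ Q : PeriodicConfiguration 3, Q.energyPerParticle lennardJones)) :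
    Summit.AtomisticToContinuum.Crystallization.Theses.ChessboardParticlePlanes.LjLaminarWindows :=
  Summit.AtomisticToContinuum.Crystallization.Theorems.LjLaminarWindowsSketch.LjLaminarWindows_of_oneWindowAllScales
    (oneWindowAllScales_of_blockCoercivity hZ hSC hPC)

/-- **Registered form (stub `stub_blockWindows` of the line's skeleton, rev 5):** `ZeroDefectDensity → SplitCoercivity →
(pinning charge, raw) → S9♭`, i.e. `oneWindowAllScales_of_blockCoercivity` with its three hypotheses as antecedents (the skeleton
composes it with its closed step S9♭ ⇒ crux).  Conditional result (door). [folklore] -/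
theorem stub_blockWindows :
    Summit.AtomisticToContinuum.Crystallization.Theses.ReggeStarCoercivity.ZeroDefectDensity →
    Summit.AtomisticToContinuum.Crystallization.Theorems.PrestressSplitKorn.SplitCoercivity →
    (∀ δ : ℝ, 0 < δ → ∀ η : ℝ, 0 < η → η ≤ 1 / 20 →
      ∃ c : ℝ, 0 < c ∧ ∀ θ : ℝ, 0 < θ → ∃ ρ C : ℝ, 0 < ρ ∧
        ∀ (N : ℕ) (x : Fin N → EuclideanSpace ℝ (Fin 3)), (∀ i j : Fin N, i ≠ j → δ ≤ dist (x i) (x j)) →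
        ∀ Ω : Finset (Fin N), (∀ i ∈ Ω, ∀ j : Fin N, dist (x j) (x i) ≤ ρ → Good x j) →
          c * ((Ω.filter fun i => LayeredNear η x i ∧
                ¬ ∃ (A : EuclideanSpace ℝ (Fin 3) →ₗᵢ[ℝ] EuclideanSpace ℝ (Fin 3)) (t : EuclideanSpace ℝ (Fin 3))
                    (a : ℝ) (s : ℤ → ℤ) (z : ℤ → ℝ),
                  (InBox a z ∧ ∀ m : ℤ, 19 / 25 ≤ z (m + 1) - z m) ∧ IsHaggSeq s ∧
                  (∀ j : Fin N, dist (x j) (x i) ≤ 2 →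
                    ∃ l : ℤ × ℤ × ℤ, dist (x j + t) (A (layeredPos a s z l)) ≤ η) ∧
                  (∀ l : ℤ × ℤ × ℤ, dist (A (layeredPos a s z l)) (x i + t) ≤ 2 →
                    ∃ j : Fin N, dist (x j + t) (A (layeredPos a s z l)) ≤ η)).card : ℝ)
            - C * ((Ω.filter fun i => ∃ j : Fin N, j ∉ Ω ∧ dist (x j) (x i) ≤ ρ).card : ℝ)
            - θ * (Ω.card : ℝ)
          ≤ ∑ i ∈ Ω, ((1 / 2 : ℝ) * siteEnergy lennardJones x i -
              ⨅ Q : PeriodicConfiguration 3, Q.energyPerParticle lennardJones)) →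
    ∀ x : (N : ℕ) → (Fin N → EuclideanSpace ℝ (Fin 3)),
      (∀ N, IsGroundState lennardJones (x N)) →
      ∀ η : ℝ, 0 < η → ∀ L : ℝ, ∃ᶠ N in Filter.atTop,
        ∃ (i : Fin N) (A : EuclideanSpace ℝ (Fin 3) →ₗᵢ[ℝ] EuclideanSpace ℝ (Fin 3)) (T : Set ℝ),
          (∀ t ∈ T, ∀ t' ∈ T, t ≠ t' → (3 : ℝ) / 4 ≤ |t - t'|) ∧
          (∀ j : Fin N, dist (x N j) (x N i) ≤ L → ∃ t ∈ T, |(A (x N j - x N i)) 2 - t| ≤ η) :=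
  fun hZ hSC hPC => oneWindowAllScales_of_blockCoercivity hZ hSC hPC

end Summit.AtomisticToContinuum.Crystallization.Theorems.StackingBlindBudgetFlatness

end
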